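import Summits.QuantumFields.YangMills.Theorems.UnitScaleTiltProp7GreenOneBlockDecayOfLetters
import Summits.QuantumFields.YangMills.Theorems.UnitScaleTiltProp7GreenPiBlockLettersEdition
import HarnessLib

/-!
# Route `UnitScaleTilt`, crux K1 «MinimiserStabilityRegPr» (stmt-QuantumFields-19200), EX rows `norm_H₁`∕`hCk` (J-slot) — NORM_G ROAD brick N6-J, FILE E2: **THE H-DOOR's `hGblk` TEXT AT
# THE SLOT `Δ₁ = DeltaOneP … T_J`, FROM WEIGHTED LETTERS AND FROM SEVEN BLOCK-SUPPORTED LETTERS** (J-slot twin of ✓D2 `hGblk_pi_of_letters` ∕ ✓D3 `hGblk_pi_of_blockLetters`)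

Cell `ym3-torus` (HUMAN RULING D-0037; rung R3 = SU(2) YM₃ on T³ — NOT d = 4, NOT infinite volume, NOT a mass gap, NOT Clay).  Fleet lead ∕ chair seat `ym-ust-19200-p1` (gen 27).
THEOREMS ONLY (0 `def`, 0 `sorry`, default heartbeats); `--supports stmt-QuantumFields-19200 --as helper`; count-neutral.

WHAT IS PROVED (ns `…Theorems.Prop7GreenOneBlockLettersEdition`; member `F n K`, `h : n ≤ K`, weights `c₀ cB > 0`, coupling `0 ≤ a`, rates `0 ≤ δ`, `0 < ν`, `δ + ν ≤ δ₁`, slot letter `T_J`).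
* ★★★ `hGblk_one_of_letters` — ✓E1 `blockDecay_rows_GTone_of_letters` in the H-DOOR's `hGblk` binder text (✓`Prop7Kernel133DoorOfKinvRow.kernel133_of_kinvRow_of_greenBlockSup`, ANY slot `Δx`,
  here `Δx := DeltaOneP … T_J`; binders `X z hXz s hs hX bd`; `C_G := 2(BV+BD)`), weighted letters quantified over the block `z`; + divergence twin.
* ★★★ `hGblk_one_of_blockLetters` — the same from SEVEN BLOCK-SUPPORTED letters at rate `δ₁`: (Gb) (Db) (c1b) (c2b) (c3b) of ✓D3 VERBATIM + (Tb) (TDb) for `T_J` (block-supported source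
  ⟹ decayed values∕divergences of `T_J`: two-block locality ✓`Prop7TJKernelLocality`), constants `×V`, `V = (2(1+1∕ν))³` (✓D3 `weighted_of_blockSupported` ×7).
CONSUMERS.  `norm_H₁`'s VALUE half (N1-H ✓p768666 ∘ ✓`Prop7HTValueRowOfKernel` ∘ H-DOOR at `Δ₁`), `hKinv` at `Δ₁` ((K2-KNIT) with δ₃(Δ₁) ⟸ this `hGblk` by px12 ✓p772864, or the cone).
HONEST SCOPE.  Bookkeeping over displayed letters; nothing of `norm_H₁`, `hCk`, the 8 EX rows, `hThm2S`, EX or the crux is proved; nothing continuum ∕ Clay.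

References: T. Bałaban, CMP **99** (1985) 389–434 [Balaban1985BackgroundPropagators] ((3.42) p.397, (3.47)–(3.49) pp.398–399, (3.134)–(3.138) pp.422–423, Thm 3.12 p.423).
-/

set_option autoImplicit false

noncomputable section

open scoped Matrix.Norms.L2Operator BigOperators InnerProductSpace ComplexConjugate
open Complex (I)

namespace Summit.QuantumFields.YangMills.Theorems.Prop7GreenOneBlockLettersEdition

open Literature.MathematicalPhysics.QuantumFieldTheory.Balaban1983to89
open Literature.MathematicalPhysics.QuantumFieldTheory.Balaban1983to89.T3ContinuumYM3Torus
open T3PrintedRegularMinimiser (RegPr)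
open T3SectALandauChart (formComp bgUnits eta eta_pos)
open B5Eq118OneStroke (iterBlockOf)
open B9TorusCalculus (torusT)
open B9Eq39Adjoint (R bondPair J)
open B9Eq310Hermitian (norm_R_le)
open B9Eq3131Pointwise (norm_I_ad_le)
open Beta.BackgroundVertices (ad ad_apply)
open B9Eq311L2Pairing (WL2)
open B11Eq103H1Complex (SiteL2K BondL2K)
open Summit.QuantumFields.YangMills.Theorems.Prop7SectET3Transport (periodsT3)
open Summit.QuantumFields.YangMills.Theorems.Prop7SectET3HilbertLetters (W₂ toL2 toL2S QL2 DL2 DstarL2 covLapSite adjoint_DL2)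
open Summit.QuantumFields.YangMills.Theorems.Prop7SectET3GaugeProjector (NS RS RS_RS)
open Summit.QuantumFields.YangMills.Theorems.Prop7SectET3WilsonHessian (DeltaEta DeltaEtaSlot DeltaEta_isSymmetric)
open Summit.QuantumFields.YangMills.Theorems.Prop7SectET3CurvedPropagators (Qk laplaceA PosOnto GT)
open Summit.QuantumFields.YangMills.Theorems.Prop7SectET3DeltaPiPInv (GprimeP gaugeCorrP DeltaPiSlotP gaugeCorrP_apply)
open Summit.QuantumFields.YangMills.Theorems.Prop7SecondOrderDict (norm_bgUnits_le_one)
open Summit.QuantumFields.YangMills.Theorems.Prop7DeltaPiDefectPairing (inner_DL2_toL2S_DeltaEta_toL2 norm_J_one_le_of_regPr)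
open Summit.QuantumFields.YangMills.Theorems.Prop7CurrentPairingPointwise (norm_apply_le_of_norm_inner_siteSingle_le norm_symm_DeltaEta_DL2_toL2S_apply_le)
open Summit.QuantumFields.YangMills.Theorems.Prop7GreenPiSupRowsOfLetters (GT_pi_eq_four_terms covLapSite_lambda₂ bootstrap_two pointwise_of_four_terms)
open Summit.QuantumFields.YangMills.Theorems.Prop7SectET3DeltaOnePInv (DeltaOneP)
open Summit.QuantumFields.YangMills.Theorems.Prop7GreenOneSupRowsOfLetters (GT_one_eq_six_terms pointwise_of_six_terms)
open Summit.QuantumFields.YangMills.Theorems.Prop7BlockDistanceWeights (tdist_iterBlockOf_le tdist_src_tgt_le_one tdist_coarse_triangle tdist_coarse_comm sum_exp_neg_mul_tdist_coarse_le)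

open Summit.QuantumFields.YangMills.Theorems.Prop7GreenPiBlockDecayLocal (DeltaEta_DL2_decay DstarL2_DeltaEta_decay)
open Summit.QuantumFields.YangMills.Theorems.Prop7GreenPiBlockLettersEdition (weighted_of_blockSupported)
open Summit.QuantumFields.YangMills.Theorems.Prop7GreenOneBlockDecayOfLetters (blockDecay_rows_GTone_of_letters)
variable {F : T3Family} {n K : ℕ} {h : n ≤ K} {c₀ cB a : ℝ}
  (TJ : GaugeField (F.P K) 0 (Matrix.specialUnitaryGroup (Fin 2) ℂ) → (BondL2K ℂ 3 (periodsT3 F K) c₀ W₂ →ₗ[ℂ] BondL2K ℂ 3 (periodsT3 F K) c₀ W₂))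

section Editions

variable [Fact (0 < c₀)] [Fact (0 < cB)]

/-- ★★★ **THE H-DOOR's `hGblk` TEXT AT `Δx := DeltaOneP … T_J`** (binders `X z hXz s hs hX bd`, `C_G := 2(BV+BD)`) from ✓E1's weighted letters quantified over the block; second
conjunct = the divergence twin. [cite: Balaban1985BackgroundPropagators, Thm 3.12 p.423, (3.42) p.397] -/
theorem hGblk_one_of_letters {α δ : ℝ} (hδ : 0 ≤ δ) (U₀ : GaugeField (F.P K) 0 (Matrix.specialUnitaryGroup (Fin 2) ℂ)) (hreg : RegPr F n K α U₀) (ha : 0 ≤ a)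
    (hp₀ : PosOnto F n K h c₀ cB a (DeltaEtaSlot F n K c₀) U₀) (hp₁ : PosOnto F n K h c₀ cB a (DeltaOneP F n K h c₀ cB a TJ) U₀)
    {BV BD C₁ C₂ C₃ CT CTD : ℝ} (hBV : 0 ≤ BV) (hBD : 0 ≤ BD) (hC₁ : 0 ≤ C₁) (hC₂ : 0 ≤ C₂) (hC₃ : 0 ≤ C₃) (hCT : 0 ≤ CT) (hCTD : 0 ≤ CTD)
    (hGw : ∀ (z : Site (F.P K) (K - n)) (Y : PBond (F.P K) 0 → Matrix (Fin 2) (Fin 2) ℂ) (m : ℝ), 0 ≤ m →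
      (∀ b, ‖Y b‖ ≤ m * Real.exp (-(δ * (Site.tdist (iterBlockOf (K - n) b.src) z : ℝ)))) →
      ∀ bd, ‖(toL2 F K c₀).symm (GT F n K h c₀ cB a (DeltaEtaSlot F n K c₀) U₀ (toL2 F K c₀ Y)) bd‖ ≤ BV * m * Real.exp (-(δ * (Site.tdist (iterBlockOf (K - n) bd.src) z : ℝ))))
    (hDw : ∀ (z : Site (F.P K) (K - n)) (Y : PBond (F.P K) 0 → Matrix (Fin 2) (Fin 2) ℂ) (m : ℝ), 0 ≤ m →
      (∀ b, ‖Y b‖ ≤ m * Real.exp (-(δ * (Site.tdist (iterBlockOf (K - n) b.src) z : ℝ)))) →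
      ∀ x, ‖(toL2S F K c₀).symm (DstarL2 F n K c₀ U₀ (GT F n K h c₀ cB a (DeltaEtaSlot F n K c₀) U₀ (toL2 F K c₀ Y))) x‖ ≤ BD * m * Real.exp (-(δ * (Site.tdist (iterBlockOf (K - n) x) z : ℝ))))
    (hc1w : ∀ (z : Site (F.P K) (K - n)) (v : Site (F.P K) 0 → Matrix (Fin 2) (Fin 2) ℂ) (m : ℝ), 0 ≤ m →
      (∀ y, ‖v y‖ ≤ m * Real.exp (-(δ * (Site.tdist (iterBlockOf (K - n) y) z : ℝ)))) →
      ∀ y, ‖(toL2S F K c₀).symm (GprimeP F n K h c₀ cB a U₀ (RS F n K h c₀ cB U₀ (toL2S F K c₀ v))) y‖ ≤ C₁ * m * Real.exp (-(δ * (Site.tdist (iterBlockOf (K - n) y) z : ℝ))))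
    (hc2w : ∀ (z : Site (F.P K) (K - n)) (v : Site (F.P K) 0 → Matrix (Fin 2) (Fin 2) ℂ) (m : ℝ), 0 ≤ m →
      (∀ y, ‖v y‖ ≤ m * Real.exp (-(δ * (Site.tdist (iterBlockOf (K - n) y) z : ℝ)))) →
      ∀ b, ‖(toL2 F K c₀).symm (DL2 F n K c₀ U₀ (GprimeP F n K h c₀ cB a U₀ (RS F n K h c₀ cB U₀ (toL2S F K c₀ v)))) b‖ ≤ C₂ * m * Real.exp (-(δ * (Site.tdist (iterBlockOf (K - n) b.src) z : ℝ))))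
    (hc3w : ∀ (z : Site (F.P K) (K - n)) (v : Site (F.P K) 0 → Matrix (Fin 2) (Fin 2) ℂ) (m : ℝ), 0 ≤ m →
      (∀ y, ‖v y‖ ≤ m * Real.exp (-(δ * (Site.tdist (iterBlockOf (K - n) y) z : ℝ)))) →
      ∀ y, ‖(toL2S F K c₀).symm (RS F n K h c₀ cB U₀ (GprimeP F n K h c₀ cB a U₀ (toL2S F K c₀ v))) y‖ ≤ C₃ * m * Real.exp (-(δ * (Site.tdist (iterBlockOf (K - n) y) z : ℝ))))
    (hTw : ∀ (z : Site (F.P K) (K - n)) (Y : PBond (F.P K) 0 → Matrix (Fin 2) (Fin 2) ℂ) (m : ℝ), 0 ≤ m →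
      (∀ b, ‖Y b‖ ≤ m * Real.exp (-(δ * (Site.tdist (iterBlockOf (K - n) b.src) z : ℝ)))) →
      ∀ bd, ‖(toL2 F K c₀).symm (TJ U₀ (toL2 F K c₀ Y)) bd‖ ≤ CT * m * Real.exp (-(δ * (Site.tdist (iterBlockOf (K - n) bd.src) z : ℝ))))
    (hTDw : ∀ (z : Site (F.P K) (K - n)) (Y : PBond (F.P K) 0 → Matrix (Fin 2) (Fin 2) ℂ) (m : ℝ), 0 ≤ m →
      (∀ b, ‖Y b‖ ≤ m * Real.exp (-(δ * (Site.tdist (iterBlockOf (K - n) b.src) z : ℝ)))) →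
      ∀ x, ‖(toL2S F K c₀).symm (DstarL2 F n K c₀ U₀ (TJ U₀ (toL2 F K c₀ Y))) x‖ ≤ CTD * m * Real.exp (-(δ * (Site.tdist (iterBlockOf (K - n) x) z : ℝ))))
    (hwin : 2 * (1 + Real.exp (4 * δ)) * α * C₁ * (BV + BD)
      + ((6 * α * (1 + Real.exp (4 * δ)) + CTD) * C₃ * (1 + C₂ + 2 * (1 + Real.exp (4 * δ)) * α * C₁ * (BV + BD)) + CT * (BV + BD)) * (1 + C₂) ≤ 1 / 2) :
    (∀ (X : PBond (F.P K) 0 → Matrix (Fin 2) (Fin 2) ℂ) (z : Site (F.P K) (K - n)), (∀ b, X b ≠ 0 → iterBlockOf (K - n) b.src = z) →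
      ∀ s : ℝ, 0 ≤ s → (∀ b, ‖X b‖ ≤ s) →
        ∀ bd : PBond (F.P K) 0, ‖(toL2 F K c₀).symm (GT F n K h c₀ cB a (DeltaOneP F n K h c₀ cB a TJ) U₀ (toL2 F K c₀ X)) bd‖
          ≤ s * (2 * (BV + BD)) * Real.exp (-(δ * (Site.tdist (P := F.P K) (iterBlockOf (K - n) bd.src) z : ℝ)))) ∧
    (∀ (X : PBond (F.P K) 0 → Matrix (Fin 2) (Fin 2) ℂ) (z : Site (F.P K) (K - n)), (∀ b, X b ≠ 0 → iterBlockOf (K - n) b.src = z) →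
      ∀ s : ℝ, 0 ≤ s → (∀ b, ‖X b‖ ≤ s) →
        ∀ x : Site (F.P K) 0, ‖(toL2S F K c₀).symm (DstarL2 F n K c₀ U₀ (GT F n K h c₀ cB a (DeltaOneP F n K h c₀ cB a TJ) U₀ (toL2 F K c₀ X))) x‖
          ≤ s * (2 * (BV + BD)) * Real.exp (-(δ * (Site.tdist (P := F.P K) (iterBlockOf (K - n) x) z : ℝ)))) := by
  refine ⟨fun X z hXz s hs hX bd => ?_, fun X z hXz s hs hX x => ?_⟩
  · have h1 := (blockDecay_rows_GTone_of_letters TJ hδ U₀ hreg ha hp₀ hp₁ z hBV hBD hC₁ hC₂ hC₃ hCT hCTD (hGw z) (hDw z) (hc1w z) (hc2w z) (hc3w z) (hTw z) (hTDw z) hwin X hXz hs hX).1 bd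
    calc _ ≤ _ := h1
      _ = _ := by ring
  · have h1 := (blockDecay_rows_GTone_of_letters TJ hδ U₀ hreg ha hp₀ hp₁ z hBV hBD hC₁ hC₂ hC₃ hCT hCTD (hGw z) (hDw z) (hc1w z) (hc2w z) (hc3w z) (hTw z) (hTDw z) hwin X hXz hs hX).2 x
    calc _ ≤ _ := h1
      _ = _ := by ring

/-- ★★★ **THE SAME FROM SEVEN BLOCK-SUPPORTED LETTERS** ((Gb)(Db)(c1b)(c2b)(c3b) of ✓D3 VERBATIM + (Tb)(TDb) for `T_J`, all at rate `δ₁ ≥ δ + ν`; constants `×V`, `V := (2(1+1∕ν))³`;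
E1's window in the `×V` constants): `C_G := 2(BV·V + BD·V)` at rate `δ`. [cite: Balaban1985BackgroundPropagators, Thm 3.12 p.423, (3.42) p.397, (3.47)–(3.49) pp.398–399] -/
theorem hGblk_one_of_blockLetters {α δ δ₁ ν : ℝ} (hδ : 0 ≤ δ) (hν : 0 < ν) (hδ₁ : δ + ν ≤ δ₁)
    (U₀ : GaugeField (F.P K) 0 (Matrix.specialUnitaryGroup (Fin 2) ℂ)) (hreg : RegPr F n K α U₀) (ha : 0 ≤ a)
    (hp₀ : PosOnto F n K h c₀ cB a (DeltaEtaSlot F n K c₀) U₀) (hp₁ : PosOnto F n K h c₀ cB a (DeltaOneP F n K h c₀ cB a TJ) U₀)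
    {BV BD C₁ C₂ C₃ CT CTD : ℝ} (hBV : 0 ≤ BV) (hBD : 0 ≤ BD) (hC₁ : 0 ≤ C₁) (hC₂ : 0 ≤ C₂) (hC₃ : 0 ≤ C₃) (hCT : 0 ≤ CT) (hCTD : 0 ≤ CTD)
    (hGb : ∀ (X : PBond (F.P K) 0 → Matrix (Fin 2) (Fin 2) ℂ) (z : Site (F.P K) (K - n)), (∀ b, X b ≠ 0 → iterBlockOf (K - n) b.src = z) →
      ∀ s : ℝ, 0 ≤ s → (∀ b, ‖X b‖ ≤ s) →
        ∀ bd : PBond (F.P K) 0, ‖(toL2 F K c₀).symm (GT F n K h c₀ cB a (DeltaEtaSlot F n K c₀) U₀ (toL2 F K c₀ X)) bd‖ ≤ s * BV * Real.exp (-(δ₁ * (Site.tdist (P := F.P K) (iterBlockOf (K - n) bd.src) z : ℝ))))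
    (hDb : ∀ (X : PBond (F.P K) 0 → Matrix (Fin 2) (Fin 2) ℂ) (z : Site (F.P K) (K - n)), (∀ b, X b ≠ 0 → iterBlockOf (K - n) b.src = z) →
      ∀ s : ℝ, 0 ≤ s → (∀ b, ‖X b‖ ≤ s) →
        ∀ x : Site (F.P K) 0, ‖(toL2S F K c₀).symm (DstarL2 F n K c₀ U₀ (GT F n K h c₀ cB a (DeltaEtaSlot F n K c₀) U₀ (toL2 F K c₀ X))) x‖ ≤ s * BD * Real.exp (-(δ₁ * (Site.tdist (P := F.P K) (iterBlockOf (K - n) x) z : ℝ))))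
    (hc1b : ∀ (v : Site (F.P K) 0 → Matrix (Fin 2) (Fin 2) ℂ) (z : Site (F.P K) (K - n)), (∀ y, v y ≠ 0 → iterBlockOf (K - n) y = z) →
      ∀ m : ℝ, 0 ≤ m → (∀ y, ‖v y‖ ≤ m) →
        ∀ y : Site (F.P K) 0, ‖(toL2S F K c₀).symm (GprimeP F n K h c₀ cB a U₀ (RS F n K h c₀ cB U₀ (toL2S F K c₀ v))) y‖ ≤ m * C₁ * Real.exp (-(δ₁ * (Site.tdist (P := F.P K) (iterBlockOf (K - n) y) z : ℝ))))
    (hc2b : ∀ (v : Site (F.P K) 0 → Matrix (Fin 2) (Fin 2) ℂ) (z : Site (F.P K) (K - n)), (∀ y, v y ≠ 0 → iterBlockOf (K - n) y = z) →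
      ∀ m : ℝ, 0 ≤ m → (∀ y, ‖v y‖ ≤ m) →
        ∀ b : PBond (F.P K) 0, ‖(toL2 F K c₀).symm (DL2 F n K c₀ U₀ (GprimeP F n K h c₀ cB a U₀ (RS F n K h c₀ cB U₀ (toL2S F K c₀ v)))) b‖ ≤ m * C₂ * Real.exp (-(δ₁ * (Site.tdist (P := F.P K) (iterBlockOf (K - n) b.src) z : ℝ))))
    (hc3b : ∀ (v : Site (F.P K) 0 → Matrix (Fin 2) (Fin 2) ℂ) (z : Site (F.P K) (K - n)), (∀ y, v y ≠ 0 → iterBlockOf (K - n) y = z) →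
      ∀ m : ℝ, 0 ≤ m → (∀ y, ‖v y‖ ≤ m) →
        ∀ y : Site (F.P K) 0, ‖(toL2S F K c₀).symm (RS F n K h c₀ cB U₀ (GprimeP F n K h c₀ cB a U₀ (toL2S F K c₀ v))) y‖ ≤ m * C₃ * Real.exp (-(δ₁ * (Site.tdist (P := F.P K) (iterBlockOf (K - n) y) z : ℝ))))
    (hTb : ∀ (X : PBond (F.P K) 0 → Matrix (Fin 2) (Fin 2) ℂ) (z : Site (F.P K) (K - n)), (∀ b, X b ≠ 0 → iterBlockOf (K - n) b.src = z) →
      ∀ s : ℝ, 0 ≤ s → (∀ b, ‖X b‖ ≤ s) →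
        ∀ bd : PBond (F.P K) 0, ‖(toL2 F K c₀).symm (TJ U₀ (toL2 F K c₀ X)) bd‖ ≤ s * CT * Real.exp (-(δ₁ * (Site.tdist (P := F.P K) (iterBlockOf (K - n) bd.src) z : ℝ))))
    (hTDb : ∀ (X : PBond (F.P K) 0 → Matrix (Fin 2) (Fin 2) ℂ) (z : Site (F.P K) (K - n)), (∀ b, X b ≠ 0 → iterBlockOf (K - n) b.src = z) →
      ∀ s : ℝ, 0 ≤ s → (∀ b, ‖X b‖ ≤ s) →
        ∀ x : Site (F.P K) 0, ‖(toL2S F K c₀).symm (DstarL2 F n K c₀ U₀ (TJ U₀ (toL2 F K c₀ X))) x‖ ≤ s * CTD * Real.exp (-(δ₁ * (Site.tdist (P := F.P K) (iterBlockOf (K - n) x) z : ℝ))))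
    (hwin : 2 * (1 + Real.exp (4 * δ)) * α * (C₁ * (2 * (1 + 1 / ν)) ^ 3) * ((BV * (2 * (1 + 1 / ν)) ^ 3) + (BD * (2 * (1 + 1 / ν)) ^ 3))
      + ((6 * α * (1 + Real.exp (4 * δ)) + (CTD * (2 * (1 + 1 / ν)) ^ 3)) * (C₃ * (2 * (1 + 1 / ν)) ^ 3) * (1 + (C₂ * (2 * (1 + 1 / ν)) ^ 3) + 2 * (1 + Real.exp (4 * δ)) * α * (C₁ * (2 * (1 + 1 / ν)) ^ 3) * ((BV * (2 * (1 + 1 / ν)) ^ 3) + (BD * (2 * (1 + 1 / ν)) ^ 3))) + (CT * (2 * (1 + 1 / ν)) ^ 3) * ((BV * (2 * (1 + 1 / ν)) ^ 3) + (BD * (2 * (1 + 1 / ν)) ^ 3))) * (1 + (C₂ * (2 * (1 + 1 / ν)) ^ 3)) ≤ 1 / 2) :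
    (∀ (X : PBond (F.P K) 0 → Matrix (Fin 2) (Fin 2) ℂ) (z : Site (F.P K) (K - n)), (∀ b, X b ≠ 0 → iterBlockOf (K - n) b.src = z) →
      ∀ s : ℝ, 0 ≤ s → (∀ b, ‖X b‖ ≤ s) →
        ∀ bd : PBond (F.P K) 0, ‖(toL2 F K c₀).symm (GT F n K h c₀ cB a (DeltaOneP F n K h c₀ cB a TJ) U₀ (toL2 F K c₀ X)) bd‖
          ≤ s * (2 * (BV * (2 * (1 + 1 / ν)) ^ 3 + BD * (2 * (1 + 1 / ν)) ^ 3)) * Real.exp (-(δ * (Site.tdist (P := F.P K) (iterBlockOf (K - n) bd.src) z : ℝ)))) ∧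
    (∀ (X : PBond (F.P K) 0 → Matrix (Fin 2) (Fin 2) ℂ) (z : Site (F.P K) (K - n)), (∀ b, X b ≠ 0 → iterBlockOf (K - n) b.src = z) →
      ∀ s : ℝ, 0 ≤ s → (∀ b, ‖X b‖ ≤ s) →
        ∀ x : Site (F.P K) 0, ‖(toL2S F K c₀).symm (DstarL2 F n K c₀ U₀ (GT F n K h c₀ cB a (DeltaOneP F n K h c₀ cB a TJ) U₀ (toL2 F K c₀ X))) x‖
          ≤ s * (2 * (BV * (2 * (1 + 1 / ν)) ^ 3 + BD * (2 * (1 + 1 / ν)) ^ 3)) * Real.exp (-(δ * (Site.tdist (P := F.P K) (iterBlockOf (K - n) x) z : ℝ)))) := by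
  have hV : 0 ≤ (2 * (1 + 1 / ν)) ^ 3 := by positivity
  -- block-additivity of the seven readers
  have hΦG : ∀ f : Site (F.P K) (K - n) → PBond (F.P K) 0 → Matrix (Fin 2) (Fin 2) ℂ,
      (fun X bd => (toL2 F K c₀).symm (GT F n K h c₀ cB a (DeltaEtaSlot F n K c₀) U₀ (toL2 F K c₀ X)) bd) (∑ z, f z) = ∑ z, (fun X bd => (toL2 F K c₀).symm (GT F n K h c₀ cB a (DeltaEtaSlot F n K c₀) U₀ (toL2 F K c₀ X)) bd) (f z) := fun f => by
    funext bd; simp only [map_sum, Finset.sum_apply]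
  have hΦD : ∀ f : Site (F.P K) (K - n) → PBond (F.P K) 0 → Matrix (Fin 2) (Fin 2) ℂ,
      (fun X x => (toL2S F K c₀).symm (DstarL2 F n K c₀ U₀ (GT F n K h c₀ cB a (DeltaEtaSlot F n K c₀) U₀ (toL2 F K c₀ X))) x) (∑ z, f z) = ∑ z, (fun X x => (toL2S F K c₀).symm (DstarL2 F n K c₀ U₀ (GT F n K h c₀ cB a (DeltaEtaSlot F n K c₀) U₀ (toL2 F K c₀ X))) x) (f z) := fun f => by
    funext x; simp only [map_sum, Finset.sum_apply]
  have hΦ1 : ∀ f : Site (F.P K) (K - n) → Site (F.P K) 0 → Matrix (Fin 2) (Fin 2) ℂ,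
      (fun X y => (toL2S F K c₀).symm (GprimeP F n K h c₀ cB a U₀ (RS F n K h c₀ cB U₀ (toL2S F K c₀ X))) y) (∑ z, f z) = ∑ z, (fun X y => (toL2S F K c₀).symm (GprimeP F n K h c₀ cB a U₀ (RS F n K h c₀ cB U₀ (toL2S F K c₀ X))) y) (f z) := fun f => by
    funext y; simp only [map_sum, Finset.sum_apply]
  have hΦ2 : ∀ f : Site (F.P K) (K - n) → Site (F.P K) 0 → Matrix (Fin 2) (Fin 2) ℂ,
      (fun X b => (toL2 F K c₀).symm (DL2 F n K c₀ U₀ (GprimeP F n K h c₀ cB a U₀ (RS F n K h c₀ cB U₀ (toL2S F K c₀ X)))) b) (∑ z, f z) = ∑ z, (fun X b => (toL2 F K c₀).symm (DL2 F n K c₀ U₀ (GprimeP F n K h c₀ cB a U₀ (RS F n K h c₀ cB U₀ (toL2S F K c₀ X)))) b) (f z) := fun f => by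
    funext b; simp only [map_sum, Finset.sum_apply]
  have hΦ3 : ∀ f : Site (F.P K) (K - n) → Site (F.P K) 0 → Matrix (Fin 2) (Fin 2) ℂ,
      (fun X y => (toL2S F K c₀).symm (RS F n K h c₀ cB U₀ (GprimeP F n K h c₀ cB a U₀ (toL2S F K c₀ X))) y) (∑ z, f z) = ∑ z, (fun X y => (toL2S F K c₀).symm (RS F n K h c₀ cB U₀ (GprimeP F n K h c₀ cB a U₀ (toL2S F K c₀ X))) y) (f z) := fun f => by
    funext y; simp only [map_sum, Finset.sum_apply]
  have hΦT : ∀ f : Site (F.P K) (K - n) → PBond (F.P K) 0 → Matrix (Fin 2) (Fin 2) ℂ,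
      (fun X bd => (toL2 F K c₀).symm (TJ U₀ (toL2 F K c₀ X)) bd) (∑ z, f z) = ∑ z, (fun X bd => (toL2 F K c₀).symm (TJ U₀ (toL2 F K c₀ X)) bd) (f z) := fun f => by
    funext bd; simp only [map_sum, Finset.sum_apply]
  have hΦTD : ∀ f : Site (F.P K) (K - n) → PBond (F.P K) 0 → Matrix (Fin 2) (Fin 2) ℂ,
      (fun X x => (toL2S F K c₀).symm (DstarL2 F n K c₀ U₀ (TJ U₀ (toL2 F K c₀ X))) x) (∑ z, f z) = ∑ z, (fun X x => (toL2S F K c₀).symm (DstarL2 F n K c₀ U₀ (TJ U₀ (toL2 F K c₀ X))) x) (f z) := fun f => by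
    funext x; simp only [map_sum, Finset.sum_apply]
  -- the seven weighted letters at rate `δ`
  have hGw := fun (z : Site (F.P K) (K - n)) (Y : PBond (F.P K) 0 → Matrix (Fin 2) (Fin 2) ℂ) (m : ℝ) (hm : 0 ≤ m)
      (hY : ∀ b, ‖Y b‖ ≤ m * Real.exp (-(δ * (Site.tdist (iterBlockOf (K - n) b.src) z : ℝ)))) (bd : PBond (F.P K) 0) =>
    weighted_of_blockSupported (fun b : PBond (F.P K) 0 => iterBlockOf (K - n) b.src) (fun bd : PBond (F.P K) 0 => iterBlockOf (K - n) bd.src) _ hΦG hBV hδ hν hδ₁ hGb z Y m hm hY bd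
  have hDw := fun (z : Site (F.P K) (K - n)) (Y : PBond (F.P K) 0 → Matrix (Fin 2) (Fin 2) ℂ) (m : ℝ) (hm : 0 ≤ m)
      (hY : ∀ b, ‖Y b‖ ≤ m * Real.exp (-(δ * (Site.tdist (iterBlockOf (K - n) b.src) z : ℝ)))) (x : Site (F.P K) 0) =>
    weighted_of_blockSupported (fun b : PBond (F.P K) 0 => iterBlockOf (K - n) b.src) (fun x : Site (F.P K) 0 => iterBlockOf (K - n) x) _ hΦD hBD hδ hν hδ₁ hDb z Y m hm hY x
  have hc1w := fun (z : Site (F.P K) (K - n)) (v : Site (F.P K) 0 → Matrix (Fin 2) (Fin 2) ℂ) (m : ℝ) (hm : 0 ≤ m)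
      (hY : ∀ y, ‖v y‖ ≤ m * Real.exp (-(δ * (Site.tdist (iterBlockOf (K - n) y) z : ℝ)))) (y : Site (F.P K) 0) =>
    weighted_of_blockSupported (fun y : Site (F.P K) 0 => iterBlockOf (K - n) y) (fun x : Site (F.P K) 0 => iterBlockOf (K - n) x) _ hΦ1 hC₁ hδ hν hδ₁ hc1b z v m hm hY y
  have hc2w := fun (z : Site (F.P K) (K - n)) (v : Site (F.P K) 0 → Matrix (Fin 2) (Fin 2) ℂ) (m : ℝ) (hm : 0 ≤ m)
      (hY : ∀ y, ‖v y‖ ≤ m * Real.exp (-(δ * (Site.tdist (iterBlockOf (K - n) y) z : ℝ)))) (b : PBond (F.P K) 0) =>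
    weighted_of_blockSupported (fun y : Site (F.P K) 0 => iterBlockOf (K - n) y) (fun bd : PBond (F.P K) 0 => iterBlockOf (K - n) bd.src) _ hΦ2 hC₂ hδ hν hδ₁ hc2b z v m hm hY b
  have hc3w := fun (z : Site (F.P K) (K - n)) (v : Site (F.P K) 0 → Matrix (Fin 2) (Fin 2) ℂ) (m : ℝ) (hm : 0 ≤ m)
      (hY : ∀ y, ‖v y‖ ≤ m * Real.exp (-(δ * (Site.tdist (iterBlockOf (K - n) y) z : ℝ)))) (y : Site (F.P K) 0) =>
    weighted_of_blockSupported (fun y : Site (F.P K) 0 => iterBlockOf (K - n) y) (fun x : Site (F.P K) 0 => iterBlockOf (K - n) x) _ hΦ3 hC₃ hδ hν hδ₁ hc3b z v m hm hY y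
  have hTw := fun (z : Site (F.P K) (K - n)) (Y : PBond (F.P K) 0 → Matrix (Fin 2) (Fin 2) ℂ) (m : ℝ) (hm : 0 ≤ m)
      (hY : ∀ b, ‖Y b‖ ≤ m * Real.exp (-(δ * (Site.tdist (iterBlockOf (K - n) b.src) z : ℝ)))) (bd : PBond (F.P K) 0) =>
    weighted_of_blockSupported (fun b : PBond (F.P K) 0 => iterBlockOf (K - n) b.src) (fun bd : PBond (F.P K) 0 => iterBlockOf (K - n) bd.src) _ hΦT hCT hδ hν hδ₁ hTb z Y m hm hY bd
  have hTDw := fun (z : Site (F.P K) (K - n)) (Y : PBond (F.P K) 0 → Matrix (Fin 2) (Fin 2) ℂ) (m : ℝ) (hm : 0 ≤ m)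
      (hY : ∀ b, ‖Y b‖ ≤ m * Real.exp (-(δ * (Site.tdist (iterBlockOf (K - n) b.src) z : ℝ)))) (x : Site (F.P K) 0) =>
    weighted_of_blockSupported (fun b : PBond (F.P K) 0 => iterBlockOf (K - n) b.src) (fun x : Site (F.P K) 0 => iterBlockOf (K - n) x) _ hΦTD hCTD hδ hν hδ₁ hTDb z Y m hm hY x
  exact hGblk_one_of_letters TJ (BV := BV * (2 * (1 + 1 / ν)) ^ 3) (BD := BD * (2 * (1 + 1 / ν)) ^ 3) (C₁ := C₁ * (2 * (1 + 1 / ν)) ^ 3)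
    (C₂ := C₂ * (2 * (1 + 1 / ν)) ^ 3) (C₃ := C₃ * (2 * (1 + 1 / ν)) ^ 3) (CT := CT * (2 * (1 + 1 / ν)) ^ 3) (CTD := CTD * (2 * (1 + 1 / ν)) ^ 3)
    hδ U₀ hreg ha hp₀ hp₁ (mul_nonneg hBV hV) (mul_nonneg hBD hV) (mul_nonneg hC₁ hV) (mul_nonneg hC₂ hV) (mul_nonneg hC₃ hV) (mul_nonneg hCT hV) (mul_nonneg hCTD hV)
    (fun z Y m hm hY bd => (hGw z Y m hm hY bd).trans (le_of_eq (by ring)))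
    (fun z Y m hm hY x => (hDw z Y m hm hY x).trans (le_of_eq (by ring)))
    (fun z v m hm hv y => (hc1w z v m hm hv y).trans (le_of_eq (by ring)))
    (fun z v m hm hv b => (hc2w z v m hm hv b).trans (le_of_eq (by ring)))
    (fun z v m hm hv y => (hc3w z v m hm hv y).trans (le_of_eq (by ring)))
    (fun z Y m hm hY bd => (hTw z Y m hm hY bd).trans (le_of_eq (by ring)))
    (fun z Y m hm hY x => (hTDw z Y m hm hY x).trans (le_of_eq (by ring)))
    hwin

end Editions

end Summit.QuantumFields.YangMills.Theorems.Prop7GreenOneBlockLettersEdition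

end
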